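import Mathlib
import HarnessLib
import Summits.ValiantsHypothesis.ValiantsHypothesis.Theorems.LacunarySymmetroidMatrixDescartesOsculationLawCuspCubic

/-!
# ValiantsHypothesis / LacunarySymmetroid — crux `MatrixDescartes` (stmt-ValiantsHypothesis-18050, V1),
# line «osculation-law»: the NON-MONIC QUARTIC cusp curve `a₄b⁴ + a₃b³ + a₂b² + a₁b + a₀` — θ-calculus

For the rank-four COLUMN `(4, s)`: `eval_Psi4`, `eval_logHessian_Psi4` (the bordered log-Hessian of
`Ψ = X₁⁴·ι a₄ + … + ι a₀` at a point, in the letter data `aₖ(t)`, `θaₖ(t)`, `θ²aₖ(t)` — the `H(t,b)` of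
`OsculationCuspQuartic.hess_pseudo_reduce_poly4`), `hessval_vertical4` (vertical rays osculate).  Twin of
`…CuspCubicNonMonicAlgebra` one degree up.  No definitions, no named facts.

Honest framing: helper algebra for a located column of an UNREGISTERED V1 law line; `OsculationLaw`, `PeelInequality`,
`MatrixDescartes`, Conjecture B and `VP ≠ VNP` are OPEN / NOT proved.
-/

-- `Summit.ValiantsHypothesis.ValiantsHypothesis.…` is the tree's mandated single-conjunct layout (Sub = Summit).
set_option linter.dupNamespace false

noncomputable section

namespace Summit.ValiantsHypothesis.ValiantsHypothesis.Theorems.LacunarySymmetroidMatrixDescartes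

open Polynomial Set
open scoped BigOperators

namespace OsculationCuspQuartic

/-! ### θ-calculus for `Ψ = X₁⁴·ι a₄ + X₁³·ι a₃ + X₁²·ι a₂ + X₁·ι a₁ + ι a₀` -/

/-- `Ψ(t,b) = a₄(t)b⁴ + a₃(t)b³ + a₂(t)b² + a₁(t)b + a₀(t)`. [folklore] -/
theorem eval_Psi4 (a₄ a₃ a₂ a₁ a₀ : ℝ[X]) (p : Fin 2 → ℝ) :
    MvPolynomial.eval p (MvPolynomial.X 1 * MvPolynomial.X 1 * MvPolynomial.X 1 * MvPolynomial.X 1 * Polynomial.aeval (MvPolynomial.X 0 : MvPolynomial (Fin 2) ℝ) a₄ + MvPolynomial.X 1 * MvPolynomial.X 1 * MvPolynomial.X 1 * Polynomial.aeval (MvPolynomial.X 0 : MvPolynomial (Fin 2) ℝ) a₃ + MvPolynomial.X 1 * MvPolynomial.X 1 * Polynomial.aeval (MvPolynomial.X 0 : MvPolynomial (Fin 2) ℝ) a₂ + MvPolynomial.X 1 * Polynomial.aeval (MvPolynomial.X 0 : MvPolynomial (Fin 2) ℝ) a₁ + Polynomial.aeval (MvPolynomial.X 0 : MvPolynomial (Fin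 2) ℝ) a₀) =
      a₄.eval (p 0) * p 1 ^ (4 : ℕ) + a₃.eval (p 0) * p 1 ^ (3 : ℕ) + a₂.eval (p 0) * p 1 ^ (2 : ℕ) + a₁.eval (p 0) * p 1 + a₀.eval (p 0) := by
  simp only [map_add, map_mul, MvPolynomial.eval_X, OsculationRankOne.eval_aevalX0]
  ring

set_option maxRecDepth 100000 in
/-- The bordered log-Hessian of `Ψ` at `p = (t,b)` in the scalars `aₖ(t)`, `θaₖ(t)`, `θ²aₖ(t)`. [folklore] -/
theorem eval_logHessian_Psi4 (a₄ a₃ a₂ a₁ a₀ : ℝ[X]) (Φ : MvPolynomial (Fin 2) ℝ) (hΦ : Φ = (MvPolynomial.X 1 * MvPolynomial.X 1 * MvPolynomial.X 1 * MvPolynomial.X 1 * Polynomial.aeval (MvPolynomial.X 0 : MvPolynomial (Fin 2) ℝ) a₄ + MvPolynomial.X 1 * MvPolynomial.X 1 * MvPolynomial.X 1 * Polynomial.aeval (MvPolynomial.X 0 : MvPolynomial (Fin 2) ℝ) a₃ + MvPolynomial.X 1 * MvPolynomial.X 1 * Polynomial.aeval (MvPolynomial.X 0 : MvPolynomial (Fin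 2) ℝ) a₂ + MvPolynomial.X 1 * Polynomial.aeval (MvPolynomial.X 0 : MvPolynomial (Fin 2) ℝ) a₁ + Polynomial.aeval (MvPolynomial.X 0 : MvPolynomial (Fin 2) ℝ) a₀))
    (p : Fin 2 → ℝ) :
    MvPolynomial.eval p
        (MvPolynomial.X 0 * MvPolynomial.pderiv 0 (MvPolynomial.X 0 * MvPolynomial.pderiv 0 Φ)
            * (MvPolynomial.X 1 * MvPolynomial.pderiv 1 Φ) ^ (2 : ℕ)
          - 2 * (MvPolynomial.X 0 * MvPolynomial.pderiv 0 (MvPolynomial.X 1 * MvPolynomial.pderiv 1 Φ))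
            * (MvPolynomial.X 0 * MvPolynomial.pderiv 0 Φ) * (MvPolynomial.X 1 * MvPolynomial.pderiv 1 Φ)
          + MvPolynomial.X 1 * MvPolynomial.pderiv 1 (MvPolynomial.X 1 * MvPolynomial.pderiv 1 Φ)
            * (MvPolynomial.X 0 * MvPolynomial.pderiv 0 Φ) ^ (2 : ℕ)) =
      (((p 0) * (derivative (R := ℝ) a₄).eval (p 0) + (p 0) ^ (2 : ℕ) * (derivative (R := ℝ) (derivative (R := ℝ) a₄)).eval (p 0)) * (p 1) ^ (4 : ℕ) + ((p 0) * (derivative (R := ℝ) a₃).eval (p 0) + (p 0) ^ (2 : ℕ) * (derivative (R := ℝ) (derivative (R := ℝ) a₃)).eval (p 0)) * (p 1) ^ (3 : ℕ)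
          + ((p 0) * (derivative (R := ℝ) a₂).eval (p 0) + (p 0) ^ (2 : ℕ) * (derivative (R := ℝ) (derivative (R := ℝ) a₂)).eval (p 0)) * (p 1) ^ (2 : ℕ) + ((p 0) * (derivative (R := ℝ) a₁).eval (p 0)
          + (p 0) ^ (2 : ℕ) * (derivative (R := ℝ) (derivative (R := ℝ) a₁)).eval (p 0)) * (p 1) + ((p 0) * (derivative (R := ℝ) a₀).eval (p 0) + (p 0) ^ (2 : ℕ) * (derivative (R := ℝ) (derivative (R := ℝ) a₀)).eval (p 0))) * (4 * a₄.eval (p 0) * (p 1) ^ (4 : ℕ)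
          + 3 * a₃.eval (p 0) * (p 1) ^ (3 : ℕ) + 2 * a₂.eval (p 0) * (p 1) ^ (2 : ℕ) + a₁.eval (p 0) * (p 1)) ^ (2 : ℕ) - 2 * (4 * ((p 0) * (derivative (R := ℝ) a₄).eval (p 0)) * (p 1) ^ (4 : ℕ)
          + 3 * ((p 0) * (derivative (R := ℝ) a₃).eval (p 0)) * (p 1) ^ (3 : ℕ) + 2 * ((p 0) * (derivative (R := ℝ) a₂).eval (p 0)) * (p 1) ^ (2 : ℕ) + ((p 0) * (derivative (R := ℝ) a₁).eval (p 0)) * (p 1)) * (((p 0) * (derivative (R := ℝ) a₄).eval (p 0)) * (p 1) ^ (4 : ℕ)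
          + ((p 0) * (derivative (R := ℝ) a₃).eval (p 0)) * (p 1) ^ (3 : ℕ) + ((p 0) * (derivative (R := ℝ) a₂).eval (p 0)) * (p 1) ^ (2 : ℕ) + ((p 0) * (derivative (R := ℝ) a₁).eval (p 0)) * (p 1)
          + ((p 0) * (derivative (R := ℝ) a₀).eval (p 0))) * (4 * a₄.eval (p 0) * (p 1) ^ (4 : ℕ) + 3 * a₃.eval (p 0) * (p 1) ^ (3 : ℕ) + 2 * a₂.eval (p 0) * (p 1) ^ (2 : ℕ) + a₁.eval (p 0) * (p 1))
          + (16 * a₄.eval (p 0) * (p 1) ^ (4 : ℕ) + 9 * a₃.eval (p 0) * (p 1) ^ (3 : ℕ) + 4 * a₂.eval (p 0) * (p 1) ^ (2 : ℕ) + a₁.eval (p 0) * (p 1)) * (((p 0) * (derivative (R := ℝ) a₄).eval (p 0)) * (p 1) ^ (4 : ℕ)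
          + ((p 0) * (derivative (R := ℝ) a₃).eval (p 0)) * (p 1) ^ (3 : ℕ) + ((p 0) * (derivative (R := ℝ) a₂).eval (p 0)) * (p 1) ^ (2 : ℕ) + ((p 0) * (derivative (R := ℝ) a₁).eval (p 0)) * (p 1)
          + ((p 0) * (derivative (R := ℝ) a₀).eval (p 0))) ^ (2 : ℕ) := by
  subst hΦ
  simp only [map_add, map_sub, map_mul, map_pow, MvPolynomial.pderiv_mul,
    MvPolynomial.pderiv_X_self, MvPolynomial.pderiv_X_of_ne (show (1 : Fin 2) ≠ 0 by decide),
    OsculationRankOne.pderiv_zero_aevalX0, OsculationRankOne.pderiv_one_aevalX0,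
    MvPolynomial.eval_X, OsculationRankOne.eval_aevalX0, map_ofNat, map_one, mul_zero, zero_mul, add_zero,
    zero_add, one_mul, mul_one]
  ring

set_option maxRecDepth 100000 in
/-- **Vertical abscissae osculate everywhere**: if `a₄(t) = a₃(t) = a₂(t) = a₁(t) = 0` then `H(Ψ)(t,b) = 0` for every
`b` (each term of `H` carries a factor `θ₁Ψ(t,b)` or `θ₁²Ψ(t,b)`). [folklore] -/
theorem hessval_vertical4 (a₄ a₃ a₂ a₁ a₀ : ℝ[X]) (t b : ℝ) (h4 : a₄.eval t = 0) (h3 : a₃.eval t = 0)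
    (h2 : a₂.eval t = 0) (h1 : a₁.eval t = 0) :
    (((t) * (derivative (R := ℝ) a₄).eval (t) + (t) ^ (2 : ℕ) * (derivative (R := ℝ) (derivative (R := ℝ) a₄)).eval (t)) * (b) ^ (4 : ℕ) + ((t) * (derivative (R := ℝ) a₃).eval (t) + (t) ^ (2 : ℕ) * (derivative (R := ℝ) (derivative (R := ℝ) a₃)).eval (t)) * (b) ^ (3 : ℕ)
          + ((t) * (derivative (R := ℝ) a₂).eval (t) + (t) ^ (2 : ℕ) * (derivative (R := ℝ) (derivative (R := ℝ) a₂)).eval (t)) * (b) ^ (2 : ℕ) + ((t) * (derivative (R := ℝ) a₁).eval (t) + (t) ^ (2 : ℕ) * (derivative (R := ℝ) (derivative (R := ℝ) a₁)).eval (t)) * (b)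
          + ((t) * (derivative (R := ℝ) a₀).eval (t) + (t) ^ (2 : ℕ) * (derivative (R := ℝ) (derivative (R := ℝ) a₀)).eval (t))) * (4 * a₄.eval (t) * (b) ^ (4 : ℕ) + 3 * a₃.eval (t) * (b) ^ (3 : ℕ)
          + 2 * a₂.eval (t) * (b) ^ (2 : ℕ) + a₁.eval (t) * (b)) ^ (2 : ℕ) - 2 * (4 * ((t) * (derivative (R := ℝ) a₄).eval (t)) * (b) ^ (4 : ℕ) + 3 * ((t) * (derivative (R := ℝ) a₃).eval (t)) * (b) ^ (3 : ℕ)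
          + 2 * ((t) * (derivative (R := ℝ) a₂).eval (t)) * (b) ^ (2 : ℕ) + ((t) * (derivative (R := ℝ) a₁).eval (t)) * (b)) * (((t) * (derivative (R := ℝ) a₄).eval (t)) * (b) ^ (4 : ℕ) + ((t) * (derivative (R := ℝ) a₃).eval (t)) * (b) ^ (3 : ℕ)
          + ((t) * (derivative (R := ℝ) a₂).eval (t)) * (b) ^ (2 : ℕ) + ((t) * (derivative (R := ℝ) a₁).eval (t)) * (b) + ((t) * (derivative (R := ℝ) a₀).eval (t))) * (4 * a₄.eval (t) * (b) ^ (4 : ℕ)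
          + 3 * a₃.eval (t) * (b) ^ (3 : ℕ) + 2 * a₂.eval (t) * (b) ^ (2 : ℕ) + a₁.eval (t) * (b)) + (16 * a₄.eval (t) * (b) ^ (4 : ℕ) + 9 * a₃.eval (t) * (b) ^ (3 : ℕ) + 4 * a₂.eval (t) * (b) ^ (2 : ℕ)
          + a₁.eval (t) * (b)) * (((t) * (derivative (R := ℝ) a₄).eval (t)) * (b) ^ (4 : ℕ) + ((t) * (derivative (R := ℝ) a₃).eval (t)) * (b) ^ (3 : ℕ) + ((t) * (derivative (R := ℝ) a₂).eval (t)) * (b) ^ (2 : ℕ)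
          + ((t) * (derivative (R := ℝ) a₁).eval (t)) * (b) + ((t) * (derivative (R := ℝ) a₀).eval (t))) ^ (2 : ℕ) = 0 := by
  rw [h4, h3, h2, h1]
  ring

end OsculationCuspQuartic

end Summit.ValiantsHypothesis.ValiantsHypothesis.Theorems.LacunarySymmetroidMatrixDescartes
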